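import Summits.BirchSwinnertonDyer.BirchSwinnertonDyer.Theses.EdixhovenFibreFiveSeven
import Summits.BirchSwinnertonDyer.BirchSwinnertonDyer.Theorems.EdixhovenFibreFiveSevenStarredOptimalManinUnitFiveSeven
import HarnessLib

/-!
# Route `EdixhovenFibreFiveSeven`, support item `StarredOptimalManinUnitFiveSevenOfKato`
# (stmt-BirchSwinnertonDyer-23811): K★ GRANTED the PUB bundle `KatoNeronAndCremonaFacts` — closed by name

Cell `pub/bsd-wall` (D-0145 line `route-BirchSwinnertonDyer-EdixhovenFibreFiveSeven`, rev 2), seat `bsd-line-edix-p1`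
(prover, g2). The route's rev-2 re-glue (planner bsd-idea-3 g2) displays the cite-only inputs of the landed
conditional theorems as the hypothesis bundle `KatoNeronAndCremonaFacts` (stmt-BirchSwinnertonDyer-23789:
F″ = `kato_neron_isIntegral_twistedSymbolSum_of_additive_five_le` ∧ Cremona's `|c₀| = 1` for `N ≤ 5·10⁵`) and files
the item `StarredOptimalManinUnitFiveSevenOfKato := KatoNeronAndCremonaFacts → StarredOptimalManinUnitFiveSeven`,
consumed by `closes` as `hS := hS' hPK`. It is exactly the item form of this seat's g0 theorem
`Theorems.starredOptimalManinUnitFiveSeven_of_kato : F″ → StarredOptimalManinUnitFiveSeven` (p581141: K★ — Manin's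
`p`-part at the `X₀(N)`-optimal curve of STARRED additive type at `p ∈ {5, 7}` with `E[p]` irreducible — from the
`p ∈ {5, 7}` tame-twist lever `ManinFrameResidueProperRTameTwist.not_dvd_c_of_tameTwist57` and the tree theorem
`Rank1Residual.Additive.eq_zero_of_prime_nsmul_eq_zero_of_addv_of_four_le`, no `p`-torsion on the starred locus),
applied to the first conjunct of the bundle. HONEST STATUS: this closes the SUPPORT item by name; the crux K★ itself
(stmt-BirchSwinnertonDyer-22226) stays CONDITIONAL on the cite-only fact F″ (XL: Kato's explicit reciprocity law +
the Kim–Nakamura/Kosters–Pannekoek receptacle), which the bundle displays and never asserts. BSD is not proved by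
any of this.
-/

set_option autoImplicit false
-- the Theorems namespace of this sub repeats the summit name by design (D-0017 nested layout)
set_option linter.dupNamespace false

namespace Summit.BirchSwinnertonDyer.BirchSwinnertonDyer.Theorems

/-- **`StarredOptimalManinUnitFiveSevenOfKato` (stmt-BirchSwinnertonDyer-23811) holds**: GRANTED the PUB bundle
`KatoNeronAndCremonaFacts` (F″ ∧ Cremona), K★ `StarredOptimalManinUnitFiveSeven` — by
`starredOptimalManinUnitFiveSeven_of_kato` (p581141) on the bundle's first conjunct F″; the Cremona conjunct is not
used. [cite: Kato2004Asterisque, (8.1.3) (p. 180), Thm. 9.7 (p. 189), Thm. 6.6 (1) (p. 163)]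
[cite: KimNakamura2020, Thm. 2.1, Cor. 2.4] [cite: KostersPannekoek2017, Thm. 1 and Cor. 2]
[cite: Mazur1977, Ch. III §5, Step 1, p. 158] -/
theorem starredOptimalManinUnitFiveSevenOfKato_proof :
    Summit.BirchSwinnertonDyer.BirchSwinnertonDyer.Theses.EdixhovenFibreFiveSeven.StarredOptimalManinUnitFiveSevenOfKato := by
  unfold Summit.BirchSwinnertonDyer.BirchSwinnertonDyer.Theses.EdixhovenFibreFiveSeven.StarredOptimalManinUnitFiveSevenOfKato
  intro h
  exact starredOptimalManinUnitFiveSeven_of_kato h.1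

end Summit.BirchSwinnertonDyer.BirchSwinnertonDyer.Theorems
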